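import Literature.Geometry.Lorentzian.TracedGaussEquationGeneral
import HarnessLib

/-!
# The Hamiltonian constraint of hypersurface data from the Gauss equation

For a spacelike immersed hypersurface `f : (Nᵐ, f^*g) → (Mᵐ⁺¹, g)` of a Lorentzian (or, more
generally, semi-Riemannian) manifold with a **timelike** unit normal field `ν` (`g(ν, ν) = −1`)
and second fundamental form `K(v, w) = g(D_v ν, df w)` (the tree's `secondFundamentalForm`), the
twice-traced Gauss equation (`scalarCurvature_inducedMetric_eq_general`,
`TracedGaussEquationGeneral.lean`; O'Neill 1983, Ch. 4, Thm. 5 and its Corollary) reads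
`S_{f^*g} = S_g + 2 Ric_g(ν, ν) − H² + |K|²`, i.e.

  `S_{f^*g} − |K|²_{f^*g} + H² = S_g + 2 Ric_g(ν, ν) = 2 G_g(ν, ν)`,

the left-hand side being the **Hamiltonian constraint function** `R(h) − |k|²_h + (tr_h k)²` of
the induced data `(h, k) = (f^*g, K)` (`InitialDataSet.hamiltonianConstraintFn`, `InitialData.lean`)
and `G = Ric − (S/2) g` the Einstein tensor (Choquet-Bruhat 2009, Ch. VI, (3.12) and Thm. 3.3;
Wald 1984, (10.2.28) with (E.2.27); Bartnik–Isenberg 2004, (2.1)). In particular the Hamiltonian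
constraint function of the data induced on a spacelike hypersurface of a **Ricci-flat** spacetime
vanishes. This file proves these statements:

* `PseudoRiemannianMetric.scalarCurvature_inducedMetric_sub_normSq_add_sq` — the identity
  `S_{f^*g} − |K|² + H² = S_g + 2 Ric_g(ν, ν)` at every point;
* `PseudoRiemannianMetric.scalarCurvature_inducedMetric_sub_normSq_add_sq_eq_einsteinTensor` —
  the same with right-hand side `2 G_g(ν, ν)`;
* `PseudoRiemannianMetric.scalarCurvature_inducedMetric_sub_normSq_add_sq_eq_zero` — vanishing
  when `Ric_g = 0` at the point (vacuum).

Everything is proved; there are no definitions and no named facts. (The momentum constraint,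
`div K − d(tr K) = Ric_g(ν, df ·)`, is the traced Codazzi equation and is not treated here.)

## References

* Y. Choquet-Bruhat, *General Relativity and the Einstein Equations*, OUP 2009, Ch. VI, §3,
  (3.12) and Thm. 3.3. [ChoquetBruhat2009]
* R. M. Wald, *General Relativity*, Chicago 1984, (10.2.28)–(10.2.30), (E.2.27). [Wald1984]
* R. Bartnik, J. Isenberg, *The constraint equations*, in: The Einstein equations and the large
  scale behavior of gravitational fields, Birkhäuser 2004, §2, (2.1)–(2.2). [BartnikIsenberg2004]
* B. O'Neill, *Semi-Riemannian geometry*, Academic Press 1983, Ch. 4, Thm. 5 and Corollary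
  (p. 100). [ONeill1983]
-/

noncomputable section

open Bundle Set Function Manifold
open scoped Manifold ContDiff Topology

namespace Literature.Geometry.Lorentzian

namespace PseudoRiemannianMetric

variable {E : Type*} [NormedAddCommGroup E] [NormedSpace ℝ E] {H : Type*} [TopologicalSpace H]
  {I : ModelWithCorners ℝ E H} {M : Type*} [TopologicalSpace M] [ChartedSpace H M]
  [IsManifold I ∞ M] [FiniteDimensional ℝ E] [CompleteSpace E]
  (g : PseudoRiemannianMetric I ∞ E (TangentSpace I : M → Type _)) [g.HasLeviCivita]
  {E' : Type*} [NormedAddCommGroup E'] [NormedSpace ℝ E'] {H' : Type*} [TopologicalSpace H']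
  {I' : ModelWithCorners ℝ E' H'} {N : Type*} [TopologicalSpace N] [ChartedSpace H' N]
  [IsManifold I' ∞ N] [FiniteDimensional ℝ E'] [CompleteSpace E'] [I'.Boundaryless] {f : N → M}
  (hpb : contMDiff_pullbackBilin I M I' N ∞) (hfi : g.IsSpacelikeImmersion I' f)
  {ν : NormalField I f}

/-- **The Hamiltonian constraint identity** (twice-contracted Gauss equation for a spacelike
hypersurface with timelike unit normal). For a smooth spacelike immersion
`f : (Nᵐ, f^*g) → (Mᵐ⁺¹, g)` with a unit normal field `ν` of sign `−1` (smooth lift to `TM`) and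
every point `y₀`:
`S_{f^*g}(y₀) − |K|²_{f^*g}(y₀) + H(y₀)² = S_g(f y₀) + 2 Ric_g(ν, ν)(f y₀)`,
where `K = secondFundamentalForm` (`K(v, w) = g(D_v ν, df w)`), `H = tr_{f^*g} K`
(`meanCurvature`) and `|K|²` is the metric square norm (`normSq`). This is
`scalarCurvature_inducedMetric_eq_general` with `ε = −1`. Choquet-Bruhat 2009, Ch. VI, (3.12);
Wald 1984, (10.2.28) with (E.2.27); O'Neill 1983, Ch. 4, Thm. 5 and Corollary.
[cite: ChoquetBruhat2009, Ch. VI, (3.12)] -/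
theorem scalarCurvature_inducedMetric_sub_normSq_add_sq
    (hν : ContMDiff I' I.tangent ∞ (fun x ↦ (TotalSpace.mk' E (f x) (ν x) : TangentBundle I M)))
    (hun : g.IsUnitNormal I' f ν (-1)) {m : ℕ}
    (hm : Module.finrank ℝ E' = m) (hm1 : Module.finrank ℝ E = m + 1) (y₀ : N) :
    haveI := (g.inducedMetric f hpb hfi).hasLeviCivita
    (g.inducedMetric f hpb hfi).scalarCurvature y₀ -
        (g.inducedMetric f hpb hfi).normSq y₀ (g.secondFundamentalForm I' f ν y₀) +
        g.meanCurvature f hpb hfi ν y₀ ^ 2 =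
      g.scalarCurvature (f y₀) + 2 * g.ricci (f y₀) (ν y₀) (ν y₀) := by
  have h := scalarCurvature_inducedMetric_eq_general g hpb hfi hν hun (by norm_num) hm hm1 y₀
  simp only [div_neg, div_one] at h
  linarith

/-- **The Hamiltonian constraint identity, Einstein-tensor form**: under the same hypotheses,
`S_{f^*g} − |K|²_{f^*g} + H² = 2 G_g(ν, ν)` with `G = Ric − (S/2) g` the Einstein tensor
(`einsteinTensor`; `g(ν, ν) = −1`). Choquet-Bruhat 2009, Ch. VI, Thm. 3.3 and Ch. VII, (1.2);
Wald 1984, (10.2.28); Bartnik–Isenberg 2004, (2.1). [cite: ChoquetBruhat2009, Ch. VI, Thm. 3.3] -/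
theorem scalarCurvature_inducedMetric_sub_normSq_add_sq_eq_einsteinTensor
    (hν : ContMDiff I' I.tangent ∞ (fun x ↦ (TotalSpace.mk' E (f x) (ν x) : TangentBundle I M)))
    (hun : g.IsUnitNormal I' f ν (-1)) {m : ℕ}
    (hm : Module.finrank ℝ E' = m) (hm1 : Module.finrank ℝ E = m + 1) (y₀ : N) :
    haveI := (g.inducedMetric f hpb hfi).hasLeviCivita
    (g.inducedMetric f hpb hfi).scalarCurvature y₀ -
        (g.inducedMetric f hpb hfi).normSq y₀ (g.secondFundamentalForm I' f ν y₀) +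
        g.meanCurvature f hpb hfi ν y₀ ^ 2 =
      2 * g.einsteinTensor (f y₀) (ν y₀) (ν y₀) := by
  rw [scalarCurvature_inducedMetric_sub_normSq_add_sq g hpb hfi hν hun hm hm1 y₀,
    einsteinTensor_apply, hun.2 y₀]
  ring

/-- **The Hamiltonian constraint of the data induced on a spacelike hypersurface of a vacuum
spacetime**: under the same hypotheses, if `Ric_g = 0` at `f y₀` then
`S_{f^*g}(y₀) − |K|²(y₀) + H(y₀)² = 0` — the Hamiltonian constraint equation for the induced data
`(f^*g, K)`. Choquet-Bruhat 2009, Ch. VI, Thm. 3.3; Bartnik–Isenberg 2004, (2.1) with `μ = 0`.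
[cite: ChoquetBruhat2009, Ch. VI, Thm. 3.3] -/
theorem scalarCurvature_inducedMetric_sub_normSq_add_sq_eq_zero
    (hν : ContMDiff I' I.tangent ∞ (fun x ↦ (TotalSpace.mk' E (f x) (ν x) : TangentBundle I M)))
    (hun : g.IsUnitNormal I' f ν (-1)) {m : ℕ}
    (hm : Module.finrank ℝ E' = m) (hm1 : Module.finrank ℝ E = m + 1) (y₀ : N)
    (hRic : g.ricci (f y₀) = 0) :
    haveI := (g.inducedMetric f hpb hfi).hasLeviCivita
    (g.inducedMetric f hpb hfi).scalarCurvature y₀ -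
        (g.inducedMetric f hpb hfi).normSq y₀ (g.secondFundamentalForm I' f ν y₀) +
        g.meanCurvature f hpb hfi ν y₀ ^ 2 = 0 := by
  rw [scalarCurvature_inducedMetric_sub_normSq_add_sq g hpb hfi hν hun hm hm1 y₀, scalarCurvature,
    hRic]
  simp [PseudoRiemannianMetric.trace]

end PseudoRiemannianMetric

end Literature.Geometry.Lorentzian

end
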